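import Summits.ValiantsHypothesis.ValiantsHypothesis.Theorems.KPlusLogSqLawStaticPathReverse
import Summits.ValiantsHypothesis.ValiantsHypothesis.Theorems.KPlusLogSqLawStaticPathTrainPA

/-!
# Route «KPlusLogSqLaw» — parametric max-weight independent set on a path has `O(n log n)` breakpoints (kink-certificate form)

HONEST FRAMING.  Helper toward the crux `WeakLifting` (item `stmt-ValiantsHypothesis-19561`, route `KPlusLogSqLaw`, cell `pub-symmetroid`,
seat val-sym-lift-p3 g6, 2026-08-27) on the line of its witness-plan stub `stub_tridiagonalSectorB`: the TROPICAL TWIN of the STATIC tridiagonal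
sector is parametric maximum-weight independent set on a path (val-sym-lift-p4 g6, `HOME/val-sym-lift-p4/STATIC-PATH-NLOGN.md`), whose number
of breakpoints the paper bounds by `8 n ⌈log₂ n⌉ + O(n)` under GENERAL POSITION (Theorem 6 there).  THIS FILE is the kernel form of that
divide-and-conquer, general-position-free except for ONE explicit non-degeneracy hypothesis: for items `1, …, n` with lines
`W t θ = w₁ t θ + w₀ t`, if no alternating interval sum of the item lines vanishes identically in either reading direction (hypotheses `hL`, `hR`:
the prefix-sum lines of every block read from the left / from the right are pairwise distinct — exactly the hypothesis of the fold lemma,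
parts 1–4), then the block optimum `opt i n` (`KPlusLogSqLawStaticPathOptDefs.lean`) admits a kink-set certificate of size at most
`66 · n · (⌊log₂ n⌋ + 2)` (`StaticPathFold.exists_cert_opt`): it is affine on every closed parameter interval whose interior misses that set,
so in particular its number of linear pieces / breakpoints is `O(n log n)`.  Ingredients (all kernel, this seat): the fold lemma in
certificate form (`pa_train`: each train contributes `≤ 4(l+1)` kinks, parts 1–4), the junction identity (`opt_junction`) and the junction
law (`pa_max`: a max of two certified functions costs the transversal zeros of the difference of the two TRAINS), the reflection
(`opt_sub_first_eq_Δ`), and halving with the union over the four boundary conditions of each block (§6).  A statement about a path DP;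
nothing here asserts anything about `WeakLifting`, `TropicalB`, `KPlusLogSqLaw`, the stub in its window, `MatrixDescartes`
(stmt-ValiantsHypothesis-18050) or `VP ≠ VNP`; the transfer to dominant chains of static tridiagonal DESIGNS (terms ↔ pieces, valuations ↔
lines) is not done here.
-/

set_option linter.dupNamespace false
set_option autoImplicit false

namespace Summit.ValiantsHypothesis.ValiantsHypothesis.Theorems.KPlusLogSqLaw

open Finset Classical PiecewiseAffine

namespace StaticPathFold

noncomputable section

variable (w₁ w₀ : ℕ → ℝ)

/-! ## 1. One junction -/

/-- **one junction** (STATIC-PATH-NLOGN §6, one boundary condition): if the left block `s+1..s+a` and its version without the last item are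
certified by `KL`, and the right block `j+1..j+b` (`j = s + a`) and its version without the first item by `KR`, then the glued block
`s+1..s+a+b` is certified by `KL ∪ KR` plus at most `8(a+1) + 8(b+1) + 1` further points (the kinks of the two trains and the transversal zeros
of their difference). [folklore] -/
theorem junction_pa (hL : (∀ s p q : ℕ, p < q → (altA (shift s w₁) p ≠ altA (shift s w₁) q ∨ altB (shift s w₀) p ≠ altB (shift s w₀) q)))
    (hR : (∀ j l p q : ℕ, p < q →
      (altA (shift 0 (rev j l w₁)) p ≠ altA (shift 0 (rev j l w₁)) q ∨ altB (shift 0 (rev j l w₀)) p ≠ altB (shift 0 (rev j l w₀)) q))) (s a b : ℕ) (ha : 1 ≤ a) (hb : 1 ≤ b) {KL KR : Finset ℝ}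
    (h1 : PA (opt w₁ w₀ s (a - 1)) KL) (h2 : PA (opt w₁ w₀ s a) KL) (h3 : PA (opt w₁ w₀ (s + a) b) KR)
    (h4 : PA (opt w₁ w₀ (s + a + 1) (b - 1)) KR) :
    ∃ E : Finset ℝ, E.card ≤ 8 * (a + 1) + 8 * (b + 1) + 1 ∧ PA (opt w₁ w₀ s (a + b)) (KL ∪ KR ∪ E) := by
  obtain ⟨a', rfl⟩ : ∃ a', a = a' + 1 := ⟨a - 1, by omega⟩
  obtain ⟨b', rfl⟩ : ∃ b', b = b' + 1 := ⟨b - 1, by omega⟩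
  simp only [Nat.add_sub_cancel] at h1 h4
  -- the two candidates of the junction identity
  have hg₁ : PA (fun θ => opt w₁ w₀ s a' θ + opt w₁ w₀ (s + (a' + 1)) (b' + 1) θ) (KL ∪ KR) := h1.add h3
  have hg₂ : PA (fun θ => opt w₁ w₀ s (a' + 1) θ + opt w₁ w₀ (s + (a' + 1) + 1) b' θ) (KL ∪ KR) := h2.add h4
  -- their difference is (minus the left train) plus (the right train), each certified by the fold lemma
  set B₁ := B (altA (shift s w₁)) (altB (shift s w₀)) (a' + 1) with hB₁
  set B₂ := B (altA (shift 0 (rev (s + (a' + 1)) (b' + 1) w₁))) (altB (shift 0 (rev (s + (a' + 1)) (b' + 1) w₀))) (b' + 1) with hB₂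
  have ht₁ : PA (Δ (shift s w₁) (shift s w₀) (a' + 1)) B₁ :=
    pa_train _ _ _ fun p q hpq _ => hL s p q hpq
  have ht₂ : PA (Δ (shift 0 (rev (s + (a' + 1)) (b' + 1) w₁)) (shift 0 (rev (s + (a' + 1)) (b' + 1) w₀)) (b' + 1)) B₂ :=
    pa_train _ _ _ fun p q hpq _ => hR (s + (a' + 1)) (b' + 1) p q hpq
  have hdiff : PA (fun θ => (opt w₁ w₀ s a' θ + opt w₁ w₀ (s + (a' + 1)) (b' + 1) θ) -
      (opt w₁ w₀ s (a' + 1) θ + opt w₁ w₀ (s + (a' + 1) + 1) b' θ)) (B₁ ∪ B₂) := by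
    refine (ht₁.neg.add ht₂).congr fun θ => ?_
    have e1 := opt_sub_eq_Δ w₁ w₀ s a' θ
    have e2 := opt_sub_first_eq_Δ w₁ w₀ (s + (a' + 1)) b' θ
    show _ = -Δ (shift s w₁) (shift s w₀) (a' + 1) θ +
      Δ (shift 0 (rev (s + (a' + 1)) (b' + 1) w₁)) (shift 0 (rev (s + (a' + 1)) (b' + 1) w₀)) (b' + 1) θ
    linarith
  have hmax := pa_max hg₁ hg₂ hdiff
  refine ⟨B₁ ∪ B₂ ∪ (finite_crossSet hdiff).toFinset, ?_, ?_⟩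
  · have c1 : B₁.card ≤ 4 * (a' + 1 + 1) := card_B_le _ _ _
    have c2 : B₂.card ≤ 4 * (b' + 1 + 1) := card_B_le _ _ _
    have c3 : (finite_crossSet hdiff).toFinset.card ≤ (B₁ ∪ B₂).card + 1 := by
      rw [← Set.ncard_eq_toFinset_card _ (finite_crossSet hdiff)]
      exact ncard_crossSet_le hdiff
    have c4 := Finset.card_union_le B₁ B₂
    calc (B₁ ∪ B₂ ∪ (finite_crossSet hdiff).toFinset).card
        ≤ (B₁ ∪ B₂).card + (finite_crossSet hdiff).toFinset.card := Finset.card_union_le _ _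
      _ ≤ 8 * (a' + 1 + 1) + 8 * (b' + 1 + 1) + 1 := by omega
  · have hj := fun θ => opt_junction w₁ w₀ s (a' + 1) (b' + 1) (by omega) (by omega) θ
    simp only [Nat.add_sub_cancel] at hj
    refine (hmax.congr fun θ => hj θ).mono ?_
    intro x hx
    simp only [Finset.mem_union] at hx ⊢
    tauto

/-! ## 2. Base blocks -/

/-- the empty block is certified by the empty set. [folklore] -/
theorem pa_opt_zero (i : ℕ) : PA (opt w₁ w₀ i 0) ∅ :=
  (pa_const 0).congr fun θ => opt_zero w₁ w₀ i θ

/-- a one-item block is certified by at most one point. [folklore] -/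
theorem exists_cert_opt_one (i : ℕ) : ∃ K : Finset ℝ, K.card ≤ 1 ∧ PA (opt w₁ w₀ i 1) K := by
  have h0 : PA (fun _ : ℝ => (0 : ℝ)) ∅ := pa_const 0
  have hW : PA (fun θ => W w₁ w₀ (i + 1) θ) ∅ := by
    refine (pa_affine (w₁ (i + 1)) (w₀ (i + 1))).congr fun θ => ?_
    rfl
  have hd : PA (fun θ => (0 : ℝ) - W w₁ w₀ (i + 1) θ) (∅ ∪ ∅) := h0.sub hW
  rw [Finset.empty_union] at hd
  have hm := pa_max h0 hW hd
  refine ⟨∅ ∪ ∅ ∪ ∅ ∪ (finite_crossSet hd).toFinset, ?_, hm.congr fun θ => opt_one w₁ w₀ i θ⟩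
  have := card_max_cert_le (K₁ := ∅) (K₂ := ∅) hd
  simpa using this

/-! ## 3. Halving -/

/-- base: blocks of length `≤ 1`. [folklore] -/
theorem exists_certAll_le_one (i n : ℕ) (hn : n ≤ 1) : ∃ K : Finset ℝ, K.card ≤ n ∧
      (PA (opt w₁ w₀ i n) K ∧ PA (opt w₁ w₀ (i + 1) (n - 1)) K ∧ PA (opt w₁ w₀ i (n - 1)) K ∧ PA (opt w₁ w₀ (i + 1) (n - 2)) K) := by
  rcases Nat.le_one_iff_eq_zero_or_eq_one.mp hn with h | h
  · subst h
    exact ⟨∅, le_rfl, pa_opt_zero w₁ w₀ i, pa_opt_zero w₁ w₀ (i + 1), pa_opt_zero w₁ w₀ i, pa_opt_zero w₁ w₀ (i + 1)⟩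
  · subst h
    obtain ⟨K, hK, hPA⟩ := exists_cert_opt_one w₁ w₀ i
    refine ⟨K, hK, hPA, ?_, ?_, ?_⟩
    · exact (pa_opt_zero w₁ w₀ (i + 1)).mono (Finset.empty_subset _)
    · exact (pa_opt_zero w₁ w₀ i).mono (Finset.empty_subset _)
    · exact (pa_opt_zero w₁ w₀ (i + 1)).mono (Finset.empty_subset _)

/-- **halving** (STATIC-PATH-NLOGN §6): blocks of length `n ≤ 2^d` admit a common certificate of their four boundary variants of size
`≤ 66 · n · (d + 1)`. [folklore] -/
theorem exists_certAll (hL : (∀ s p q : ℕ, p < q → (altA (shift s w₁) p ≠ altA (shift s w₁) q ∨ altB (shift s w₀) p ≠ altB (shift s w₀) q)))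
    (hR : (∀ j l p q : ℕ, p < q →
      (altA (shift 0 (rev j l w₁)) p ≠ altA (shift 0 (rev j l w₁)) q ∨ altB (shift 0 (rev j l w₀)) p ≠ altB (shift 0 (rev j l w₀)) q))) :
    ∀ d n : ℕ, n ≤ 2 ^ d → ∀ i : ℕ, ∃ K : Finset ℝ, K.card ≤ 66 * n * (d + 1) ∧
      (PA (opt w₁ w₀ i n) K ∧ PA (opt w₁ w₀ (i + 1) (n - 1)) K ∧ PA (opt w₁ w₀ i (n - 1)) K ∧ PA (opt w₁ w₀ (i + 1) (n - 2)) K) := by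
  intro d
  induction d with
  | zero =>
    intro n hn i
    obtain ⟨K, hK, hC⟩ := exists_certAll_le_one w₁ w₀ i n (by simpa using hn)
    exact ⟨K, by omega, hC⟩
  | succ d ih =>
    intro n hn i
    by_cases hsmall : n ≤ 2 ^ d
    · obtain ⟨K, hK, hC⟩ := ih n hsmall i
      exact ⟨K, hK.trans (by nlinarith), hC⟩
    · -- `2^d < n ≤ 2^(d+1)`: split after `l₁ = n / 2` items
      have hn2 : 2 ≤ n := by
        have : 1 ≤ 2 ^ d := Nat.one_le_two_pow
        omega
      set l₁ := n / 2 with hl₁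
      set l₂ := n - l₁ with hl₂
      have hl₁1 : 1 ≤ l₁ := by omega
      have hl₂1 : 1 ≤ l₂ := by omega
      have hl₁d : l₁ ≤ 2 ^ d := by rw [pow_succ] at hn; omega
      have hl₂d : l₂ ≤ 2 ^ d := by rw [pow_succ] at hn; omega
      have hn12 : l₁ + l₂ = n := by omega
      obtain ⟨KL, hKL, hL1, hL2, hL3, hL4⟩ := ih l₁ hl₁d i
      obtain ⟨KR, hKR, hR1, hR2, hR3, hR4⟩ := ih l₂ hl₂d (i + l₁)
      -- variant (0,0): left `i, l₁`, right `i+l₁, l₂`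
      obtain ⟨E₀₀, hE₀₀, hP₀₀⟩ := junction_pa w₁ w₀ hL hR i l₁ l₂ hl₁1 hl₂1 hL3 hL1 hR1 hR2
      -- variant (0,1): left `i, l₁`, right `i+l₁, l₂ - 1` (or the left block itself if `l₂ = 1`)
      have hV₀₁ : ∃ E : Finset ℝ, E.card ≤ 8 * (l₁ + 1) + 8 * (l₂ + 1) + 1 ∧ PA (opt w₁ w₀ i (n - 1)) (KL ∪ KR ∪ E) := by
        by_cases h : 1 ≤ l₂ - 1
        · have hR4' : PA (opt w₁ w₀ (i + l₁ + 1) (l₂ - 1 - 1)) KR := by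
            have : l₂ - 1 - 1 = l₂ - 2 := by omega
            rw [this]; exact hR4
          obtain ⟨E, hE, hP⟩ := junction_pa w₁ w₀ hL hR i l₁ (l₂ - 1) hl₁1 h hL3 hL1 hR3 hR4'
          refine ⟨E, by omega, ?_⟩
          have : l₁ + (l₂ - 1) = n - 1 := by omega
          rw [this] at hP; exact hP
        · refine ⟨∅, by rw [Finset.card_empty]; omega, ?_⟩
          have : n - 1 = l₁ := by omega
          rw [this, Finset.union_empty]
          exact hL1.mono Finset.subset_union_left
      -- variant (1,0): left `i+1, l₁ - 1`, right `i+l₁, l₂` (or the right block itself if `l₁ = 1`)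
      have hV₁₀ : ∃ E : Finset ℝ, E.card ≤ 8 * (l₁ + 1) + 8 * (l₂ + 1) + 1 ∧ PA (opt w₁ w₀ (i + 1) (n - 1)) (KL ∪ KR ∪ E) := by
        by_cases h : 1 ≤ l₁ - 1
        · have hL4' : PA (opt w₁ w₀ (i + 1) (l₁ - 1 - 1)) KL := by
            have : l₁ - 1 - 1 = l₁ - 2 := by omega
            rw [this]; exact hL4
          have hR1' : PA (opt w₁ w₀ (i + 1 + (l₁ - 1)) l₂) KR := by
            have : i + 1 + (l₁ - 1) = i + l₁ := by omega
            rw [this]; exact hR1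
          have hR2' : PA (opt w₁ w₀ (i + 1 + (l₁ - 1) + 1) (l₂ - 1)) KR := by
            have : i + 1 + (l₁ - 1) + 1 = i + l₁ + 1 := by omega
            rw [this]; exact hR2
          obtain ⟨E, hE, hP⟩ := junction_pa w₁ w₀ hL hR (i + 1) (l₁ - 1) l₂ h hl₂1 hL4' hL2 hR1' hR2'
          refine ⟨E, by omega, ?_⟩
          have : l₁ - 1 + l₂ = n - 1 := by omega
          rw [this] at hP; exact hP
        · refine ⟨∅, by rw [Finset.card_empty]; omega, ?_⟩
          have e1 : n - 1 = l₂ := by omega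
          have e2 : i + 1 = i + l₁ := by omega
          rw [e1, e2, Finset.union_empty]
          exact hR1.mono Finset.subset_union_right
      -- variant (1,1): left `i+1, l₁ - 1`, right `i+l₁, l₂ - 1`
      have hV₁₁ : ∃ E : Finset ℝ, E.card ≤ 8 * (l₁ + 1) + 8 * (l₂ + 1) + 1 ∧ PA (opt w₁ w₀ (i + 1) (n - 2)) (KL ∪ KR ∪ E) := by
        by_cases ha : 1 ≤ l₁ - 1
        · by_cases hb : 1 ≤ l₂ - 1
          · have hL4' : PA (opt w₁ w₀ (i + 1) (l₁ - 1 - 1)) KL := by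
              have : l₁ - 1 - 1 = l₁ - 2 := by omega
              rw [this]; exact hL4
            have hR3' : PA (opt w₁ w₀ (i + 1 + (l₁ - 1)) (l₂ - 1)) KR := by
              have : i + 1 + (l₁ - 1) = i + l₁ := by omega
              rw [this]; exact hR3
            have hR4' : PA (opt w₁ w₀ (i + 1 + (l₁ - 1) + 1) (l₂ - 1 - 1)) KR := by
              have e1 : i + 1 + (l₁ - 1) + 1 = i + l₁ + 1 := by omega
              have e2 : l₂ - 1 - 1 = l₂ - 2 := by omega
              rw [e1, e2]; exact hR4
            obtain ⟨E, hE, hP⟩ := junction_pa w₁ w₀ hL hR (i + 1) (l₁ - 1) (l₂ - 1) ha hb hL4' hL2 hR3' hR4'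
            refine ⟨E, by omega, ?_⟩
            have : l₁ - 1 + (l₂ - 1) = n - 2 := by omega
            rw [this] at hP; exact hP
          · refine ⟨∅, by rw [Finset.card_empty]; omega, ?_⟩
            have : n - 2 = l₁ - 1 := by omega
            rw [this, Finset.union_empty]
            exact hL2.mono Finset.subset_union_left
        · refine ⟨∅, by rw [Finset.card_empty]; omega, ?_⟩
          have e1 : n - 2 = l₂ - 1 := by omega
          have e2 : i + 1 = i + l₁ := by omega
          rw [e1, e2, Finset.union_empty]
          exact hR3.mono Finset.subset_union_right
      obtain ⟨E₀₁, hE₀₁, hP₀₁⟩ := hV₀₁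
      obtain ⟨E₁₀, hE₁₀, hP₁₀⟩ := hV₁₀
      obtain ⟨E₁₁, hE₁₁, hP₁₁⟩ := hV₁₁
      rw [hn12] at hP₀₀
      refine ⟨KL ∪ KR ∪ (E₀₀ ∪ E₀₁ ∪ E₁₀ ∪ E₁₁), ?_, ?_, ?_, ?_, ?_⟩
      · -- the count: `|KL| + |KR| + 4 (8 n + 17) ≤ 66 n (d + 2)`
        have c0 := Finset.card_union_le (KL ∪ KR) (E₀₀ ∪ E₀₁ ∪ E₁₀ ∪ E₁₁)
        have c1 := Finset.card_union_le KL KR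
        have c2 := Finset.card_union_le (E₀₀ ∪ E₀₁ ∪ E₁₀) E₁₁
        have c3 := Finset.card_union_le (E₀₀ ∪ E₀₁) E₁₀
        have c4 := Finset.card_union_le E₀₀ E₀₁
        have hbudget : KL.card + KR.card + 4 * (8 * (l₁ + 1) + 8 * (l₂ + 1) + 1) ≤ 66 * n * (d + 1 + 1) := by
          have e1 : KL.card + KR.card ≤ 66 * n * (d + 1) := by
            calc KL.card + KR.card ≤ 66 * l₁ * (d + 1) + 66 * l₂ * (d + 1) := Nat.add_le_add hKL hKR
              _ = 66 * n * (d + 1) := by rw [← hn12]; ring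
          nlinarith
        omega
      · exact hP₀₀.mono (by intro x hx; simp only [Finset.mem_union] at hx ⊢; tauto)
      · exact hP₁₀.mono (by intro x hx; simp only [Finset.mem_union] at hx ⊢; tauto)
      · exact hP₀₁.mono (by intro x hx; simp only [Finset.mem_union] at hx ⊢; tauto)
      · exact hP₁₁.mono (by intro x hx; simp only [Finset.mem_union] at hx ⊢; tauto)

/-! ## 4. The count -/

/-- **`O(n log n)` KINK CERTIFICATE FOR THE PATH OPTIMUM** (STATIC-PATH-NLOGN Theorem 6, kernel form, no general position beyond the
non-vanishing of alternating interval sums): the block optimum `opt i n` is affine on every closed parameter interval whose interior misses a set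
of at most `66 · n · (⌊log₂ n⌋ + 2)` points. [folklore] -/
theorem exists_cert_opt (hL : (∀ s p q : ℕ, p < q → (altA (shift s w₁) p ≠ altA (shift s w₁) q ∨ altB (shift s w₀) p ≠ altB (shift s w₀) q)))
    (hR : (∀ j l p q : ℕ, p < q →
      (altA (shift 0 (rev j l w₁)) p ≠ altA (shift 0 (rev j l w₁)) q ∨ altB (shift 0 (rev j l w₀)) p ≠ altB (shift 0 (rev j l w₀)) q))) (i n : ℕ) :
    ∃ K : Finset ℝ, K.card ≤ 66 * n * (Nat.log 2 n + 2) ∧ PA (opt w₁ w₀ i n) K := by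
  have hn : n ≤ 2 ^ (Nat.log 2 n + 1) := (Nat.lt_pow_succ_log_self one_lt_two n).le
  obtain ⟨K, hK, hC⟩ := exists_certAll w₁ w₀ hL hR (Nat.log 2 n + 1) n hn i
  exact ⟨K, hK, hC.1⟩

end

end StaticPathFold

end Summit.ValiantsHypothesis.ValiantsHypothesis.Theorems.KPlusLogSqLaw
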